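import Literature.IUT.HodgeArakelov.RealifiedPrimeStripSplitComponent

/-!
# [IUTchII] Def 4.9 (viii) / [IUTchI] Def 5.2 (iv), Rmk 5.2.1 (ii): at strips whose global realified Frobenioid is
# DEGREE-CLASSIFIED the global component of a morphism of `F^{⊩▶×μ}`-prime-strips is RIGID — determined by, and
# uniquely extending, the local part (disposition of D-L6t22-R9F1a; delimitation of finding R9-F1)

Proof-only companion (abc-iut cell, layer L6; abc-iut-L6-t22 gen 10; 0 definitions, nothing landed is re-typed) of
abc-iut-L6-t2's `RealifiedPrimeStripSplitCategories.lean` (print-level groupoid `FVdashSplitTriMuPrimeStrip P G X` of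
`F^{⊩▶×μ}`-prime-strips, [IUTchII] Def 4.9 (viii)) and of abc-iut-w5-d087's `RealifiedPrimeStripSplitComponent.lean`
(the explicit witness strip with global realified Frobenioid `realLine`).

PRINT (read on the cell's renders `lit/renders/IUTchI-kurims-url-690e7b3c6199`, `IUTchII-kurims-url-5036b4059555`,
`FrdI-kurims-url-bbf705efa10f`; claim key `Mochizuki2012` DISPUTED, D-0012). [IUTchII] Def 4.9 (viii) p. 158: "A
morphism of `F^{⊩▶×μ}`-prime-strips is defined to be an isomorphism between collections of data as discussed above"
— the data being "`(*C^⊩, Prime(*C^⊩) ⥲ V, *F^{⊢▶×μ}, {*ρ_v}_{v∈V})` satisfying the conditions (a), (b), (c), (d),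
(e), (f) of [IUTchI], Definition 5.2, (iv)"; [IUTchI] Def 5.2 (iv) p. 135: "(e) `‡ρ_v : Φ_{‡C^⊩,v} ⥲ Φ^rlf_{‡C^⊢_v}` …
is an isomorphism of topological monoids [both of which are, in fact, isomorphic to `ℝ_{≥0}`]; (f) the collection of
data in the above display is isomorphic to the collection of data `F^⊩_mod` of Example 3.5, (ii)"; [IUTchI] Rmk 5.2.1
(ii) p. 143: "the relatively simple structure of the category `C^⊩_mod`, i.e., which may be summarized, roughly
speaking, as a collection, indexed by `V ⥲ V_mod`, of copies of the topological monoid `ℝ_{≥0}`, which are related to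
one another by a 'product formula' … the rigidity of the divisor monoids"; [IUTchI] Ex 3.5 (i) p. 84: `C^⊩_mod` is
"the realification … of the Frobenioid of [FrdI], Example 6.3 … associated to the number field `F_mod` and the trivial
Galois extension"; [FrdI] Thm 6.4 (i) p. 114: "`deg^arith_L` determines an isomorphism of groups
`δ_A : Pic_Φ(A) ⥲ ℝ`" (proof p. 115: "the image of `Φ^birat(L) ⊗_ℤ ℝ` … is equal to the set of elements … whose image
under `deg^arith_L` is `0` … Dirichlet unit theorem"), (ii) p. 114: an equivalence of realifications has a degree
`deg(Ψ^rlf) ∈ ℝ_{>0}` rescaling `δ`; [IUTchII] Cor 4.6 (ii) p. 138: "an isomorphism of Frobenioids … uniquely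
determined by the condition that it be compatible with the respective bijections `Prime(−) ⥲ V̲` and local
isomorphisms of topological monoids for each `v ∈ V̲`". [cite: Mochizuki2012, Def 4.9 (viii) p.158]
[cite: MochizukiFrdI2008, Thm. 6.4 (i) p.114]

THE FINDING BEING DISPOSED OF. R9-F1 (abc-iut-L6-t22 gen 9; lane O concurred; disclosed doc-only in the v3 header of
`RealifiedPrimeStripSplitCategories.lean`, p417676): the GLOBAL component `Hom.classEquiv` of the typed morphism is
constrained only by `degClass_eq` and `map_pilotClass`, so "every permutation of the isomorphism classes of `*C^⊩`
preserving total degree and fixing the pilot class is an automorphism with identity local part" (kernel witness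
`autOfDegPerm`) — LOOSER THAN PRINT; post-freeze repair rows (a′) "type the global component as an isomorphism of
(model) Frobenioids compatible with `Prime ⥲ V` and the `ρ_v`" and (c′) "a model-condition on the strip datum"
(L6-lead §F v1.18e (3)/v1.18l; NODES IUTchII:Def4.9(viii)).

WHAT IS PROVED HERE (elementary; hypotheses BY NAME, no new `Prop` definition).
* §1 EXACT DELIMITATION of R9-F1: a strip `S` admits a non-identity automorphism with identity local part IFF two
  DISTINCT isomorphism classes of `*C^⊩`, both different from the pilot class, have the same degree
  (`exists_aut_ne_id_iff_exists_classes`); in particular NONE exists as soon as `degClass` is injective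
  (`eq_id_of_locSplitIso_eq_refl`).  So the looseness lives exactly at instances of the INTERFACE record
  `RealifiedGlobalFrobenioidF` violating the printed classification of isomorphism classes by degree.
* §2 RIGIDITY under the printed classification ("DEGREE-CLASSIFIED": `degClass : IsoClass(*C^⊩) → ℝ` injective — [FrdI]
  Thm 6.4 (i) `δ_A : Pic_Φ(A) ⥲ ℝ` for `C^⊩_mod`, transported by Def 5.2 (iv)(f) "isomorphic to `F^⊩_mod`"): for a
  degree-classified TARGET `T`, any two morphisms `S ⟶ T` have THE SAME global component
  (`Hom.classEquiv_eq_classEquiv`), a morphism is determined by its local part (`Hom.ext_of_locSplitIso_eq`), passing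
  to the `F^{⊢▶×μ}`-prime-strip (`toSplitStripFunctor`) is injective on `Hom(S, T)` (`toSplitStripFunctor_map_injective`),
  every automorphism has identity global component (`Hom.classEquiv_eq_refl`) — the shape of [IUTchII] Cor 4.6 (ii)
  "uniquely determined by … `Prime(−) ⥲ V̲` and local isomorphisms" and of [FrdI] Thm 6.4 (ii) with `deg(Ψ^rlf)` pinned
  to `1` by `ρ`-compatibility (abc-iut-w4-d009's `RlfData.eq_id_of_isFrobPreservingAt` in the divisor-monoid currency).
* §3 FULLNESS / UNIQUE EXTENSION when source and target are degree-classified ONTO `ℝ` (`degClass` bijective — [FrdI]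
  Thm 6.4 (i): `δ_A` is onto): every `V`-family of split local isomorphisms compatible with the `ρ_v` and the
  generators at bad places EXTENDS UNIQUELY to a morphism of `F^{⊩▶×μ}`-prime-strips (`existsUnique_hom_of_local`); the
  hom-set IS the set of compatible local isomorphisms (`locSplitIso_bijective`), and `S ≅ T` iff a compatible local
  isomorphism exists (`nonempty_iso_iff_exists_local`).  The local data alone pin the pilot object's local degrees and
  degree (`pilot_localDeg_eq_of_local`, `pilot_deg_eq_of_local`) — Def 4.9 (viii) "the generators … together with the
  `{*ρ_w}`, determine … the pilot object".
* §4 NON-VACUITY of the hypothesis: abc-iut-w5-d087's `Witness.realLine` (objects `ℝ`, isomorphism `=`, `deg = id`) is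
  degree-classified onto `ℝ` (`realLine_degClass_bijective`), and the explicit witness strip over it exists
  (`Witness.nonempty_degClassified`).  The genuine number-field model (abc-iut-w5-d153's categorical realified
  Frobenioid `Prop37.FrakRlfCat F`: `nonempty_iso_iff_frakDeg_eq`, `frakDeg_obj_surjective`) is the companion junction
  file `LogThetaLattice/GlobalLGPFrobenioidsRealifiedDegClassified.lean`.

CONSEQUENCE FOR THE D-ROWS (stated, not adjudicated): at degree-classified instances — the only ones print admits,
Def 5.2 (iv)(f) — the typed global component coincides with what the printed isomorphism of Frobenioids induces on
isomorphism classes and carries NO freedom; a Frobenioid-structured re-typing of `Hom` (row (a′)) would add no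
constraint there, and the residual of R9-F1 is the MODEL CONDITION (row (c′)), supplied here as the named hypothesis
`Function.Injective/Bijective (·).data.realifiedF.degClass` rather than as a new field (the frozen record is untouched).
HONEST FRAMING: bookkeeping over the cell's own typed records; nothing here asserts a disputed claim or takes a side
on [IUTchIII] Cor 3.12; typed ≠ proved for every interface-level statement upstream.
-/

namespace Literature.IUT.HodgeArakelov

open CategoryTheory

universe u v w

/-! ### §0 Degree-classified realified global Frobenioids: class-level rigidity -/

namespace RealifiedGlobalFrobenioidF

variable {V : Type u} (C : RealifiedGlobalFrobenioidF.{u, v} V)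

/-- **IUTchI:Rmk5.2.1(ii)** (kurims p.143) / [FrdI] Thm 6.4 (i): when isomorphism classes are classified by degree, two
objects have the same class iff they have the same degree. [cite: MochizukiFrdI2008, Thm. 6.4 (i) p.114] -/
theorem classOf_eq_classOf_iff_deg_eq (hC : Function.Injective C.degClass) (a b : C.Obj) :
    C.classOf a = C.classOf b ↔ C.deg a = C.deg b := by
  constructor
  · intro h
    rw [← degClass_classOf, ← degClass_classOf, h]
  · intro h
    exact hC (by rw [degClass_classOf, degClass_classOf, h])

/-- **IUTchI:Rmk5.2.1(ii)** (kurims p.143) / [FrdI] Thm 6.4 (i): when isomorphism classes are classified by degree, two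
objects are isomorphic iff they have the same degree. [cite: MochizukiFrdI2008, Thm. 6.4 (i) p.114] -/
theorem iso_iff_deg_eq (hC : Function.Injective C.degClass) (a b : C.Obj) : C.Iso a b ↔ C.deg a = C.deg b := by
  rw [← classOf_eq_classOf_iff, classOf_eq_classOf_iff_deg_eq C hC]

/-- RIGIDITY of the class permutations: a degree-preserving permutation of the isomorphism classes of a
degree-classified `*C^⊩` is the identity (so abc-iut-L6-t22 gen 9's `autOfDegPerm σ` is the identity there).
[cite: MochizukiFrdI2008, Thm. 6.4 (i) p.114] -/
theorem perm_eq_refl_of_degClass_eq (hC : Function.Injective C.degClass) (σ : Equiv.Perm C.IsoClass)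
    (hσ : ∀ c, C.degClass (σ c) = C.degClass c) : σ = Equiv.refl _ :=
  Equiv.ext fun c => hC (hσ c)

variable {C}

/-- UNIQUENESS of degree-matching bijections of classes into a degree-classified target ([FrdI] Thm 6.4 (ii) with
`deg(Ψ^rlf) = 1`: the induced `Pic_Φ(A₁) ⥲ Pic_Φ(A₂)` is `δ_{A₂}⁻¹ ∘ δ_{A₁}`). [cite: MochizukiFrdI2008, Thm. 6.4 (ii) p.114] -/
theorem equiv_eq_of_degClass_eq {D : RealifiedGlobalFrobenioidF.{u, v} V} (hD : Function.Injective D.degClass)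
    (e e' : C.IsoClass ≃ D.IsoClass) (he : ∀ c, D.degClass (e c) = C.degClass c)
    (he' : ∀ c, D.degClass (e' c) = C.degClass c) : e = e' :=
  Equiv.ext fun c => hD ((he c).trans (he' c).symm)

/-- EXISTENCE of the degree-matching bijection of classes between two realified global Frobenioids that are
degree-classified ONTO `ℝ` (`δ_{A₂}⁻¹ ∘ δ_{A₁}`). [cite: MochizukiFrdI2008, Thm. 6.4 (i) p.114] -/
theorem exists_equiv_degClass_eq {D : RealifiedGlobalFrobenioidF.{u, v} V} (hC : Function.Bijective C.degClass)
    (hD : Function.Bijective D.degClass) :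
    ∃ e : C.IsoClass ≃ D.IsoClass, ∀ c, D.degClass (e c) = C.degClass c :=
  ⟨(Equiv.ofBijective _ hC).trans (Equiv.ofBijective _ hD).symm, fun c =>
    Equiv.ofBijective_apply_symm_apply D.degClass hD (C.degClass c)⟩

end RealifiedGlobalFrobenioidF

namespace FVdashSplitTriMuPrimeStrip

variable {V : Type u} {P : PlaceData V} {G : V → Type u} [∀ v, Group (G v)]
  {X : ∀ v, GroupTheoreticUnits.{u, w} (G v)} {S T : FVdashSplitTriMuPrimeStrip.{u, v, w} P G X}

/-! ### §1 Exact delimitation of R9-F1: when does a strip have extra automorphisms with identity local part? -/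

/-- A non-identity automorphism with IDENTITY local part moves some class `c` to a DIFFERENT class of the same degree,
and neither `c` nor its image is the pilot class. (bookkeeping) [cite: Mochizuki2012, Def 4.9 (viii) p.158] -/
theorem exists_classes_of_aut_ne_id (f : S ⟶ S) (hf : f ≠ 𝟙 S)
    (hloc : ∀ v, f.locSplitIso v = LocalTriMuDatum.SplitIso.refl _) :
    ∃ c₁ c₂ : S.data.realifiedF.IsoClass, c₁ ≠ c₂ ∧
      S.data.realifiedF.degClass c₁ = S.data.realifiedF.degClass c₂ ∧
      c₁ ≠ S.data.realifiedF.classOf S.data.pilot ∧ c₂ ≠ S.data.realifiedF.classOf S.data.pilot := by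
  classical
  by_contra hno
  apply hf
  refine Hom.ext' (Equiv.ext fun c => ?_) (funext hloc)
  show f.classEquiv c = c
  by_contra hc
  refine hno ⟨f.classEquiv c, c, hc, f.degClass_eq c, ?_, ?_⟩
  · intro h
    apply hc
    have hp := f.map_pilotClass
    rw [← h] at hp
    exact f.classEquiv.injective hp
  · intro h
    apply hc
    rw [h, f.map_pilotClass]

/-- Conversely, two DISTINCT classes of the same degree, both different from the pilot class, give a NON-IDENTITY
automorphism with identity local part (their transposition; abc-iut-L6-t22 gen 9's `autOfDegPerm` made sharp).
(bookkeeping) [cite: Mochizuki2012, Def 4.9 (viii) p.158] -/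
theorem exists_aut_ne_id_of_classes (c₁ c₂ : S.data.realifiedF.IsoClass) (hne : c₁ ≠ c₂)
    (hdeg : S.data.realifiedF.degClass c₁ = S.data.realifiedF.degClass c₂)
    (h₁ : c₁ ≠ S.data.realifiedF.classOf S.data.pilot) (h₂ : c₂ ≠ S.data.realifiedF.classOf S.data.pilot) :
    ∃ f : S ⟶ S, f ≠ 𝟙 S ∧ ∀ v, f.locSplitIso v = LocalTriMuDatum.SplitIso.refl _ := by
  classical
  refine ⟨{ classEquiv := Equiv.swap c₁ c₂
            degClass_eq := fun c => ?_
            map_pilotClass := Equiv.swap_apply_of_ne_of_ne h₁.symm h₂.symm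
            locSplitIso := fun v => LocalTriMuDatum.SplitIso.refl _
            map_rho := fun v a => by rw [LocalTriMuDatum.SplitIso.eTri_refl, MulEquiv.refl_apply]
            map_triGen := fun v h => by rw [LocalTriMuDatum.SplitIso.eTri_refl, MulEquiv.refl_apply] }, ?_,
    fun v => rfl⟩
  · rcases eq_or_ne c c₁ with rfl | hc₁
    · rw [Equiv.swap_apply_left, hdeg]
    rcases eq_or_ne c c₂ with rfl | hc₂
    · rw [Equiv.swap_apply_right, hdeg]
    rw [Equiv.swap_apply_of_ne_of_ne hc₁ hc₂]
  · intro h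
    have h' := congrArg (fun g : S ⟶ S => g.classEquiv c₁) h
    simp only [Equiv.swap_apply_left] at h'
    exact hne.symm h'

/-- **IUTchII:Def4.9(viii)** (kurims p.158) EXACT DELIMITATION of finding R9-F1: a print-level `F^{⊩▶×μ}`-prime-strip has
a non-identity automorphism with identity local part IFF its global realified Frobenioid has two distinct isomorphism
classes of equal degree both different from the pilot class — i.e. iff `*C^⊩` VIOLATES the printed classification of
isomorphism classes by degree away from the pilot class. [cite: Mochizuki2012, Def 4.9 (viii) p.158] -/
theorem exists_aut_ne_id_iff_exists_classes (S : FVdashSplitTriMuPrimeStrip.{u, v, w} P G X) :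
    (∃ f : S ⟶ S, f ≠ 𝟙 S ∧ ∀ v, f.locSplitIso v = LocalTriMuDatum.SplitIso.refl _) ↔
      ∃ c₁ c₂ : S.data.realifiedF.IsoClass, c₁ ≠ c₂ ∧
        S.data.realifiedF.degClass c₁ = S.data.realifiedF.degClass c₂ ∧
        c₁ ≠ S.data.realifiedF.classOf S.data.pilot ∧ c₂ ≠ S.data.realifiedF.classOf S.data.pilot := by
  constructor
  · rintro ⟨f, hf, hloc⟩
    exact exists_classes_of_aut_ne_id f hf hloc
  · rintro ⟨c₁, c₂, hne, hdeg, h₁, h₂⟩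
    exact exists_aut_ne_id_of_classes c₁ c₂ hne hdeg h₁ h₂

/-! ### §2 Rigidity of the global component at a degree-classified target -/

namespace Hom

/-- **IUTchII:Cor4.6(ii)** (kurims p.138) «uniquely determined by … `Prime(−) ⥲ V̲` and local isomorphisms», class
level: into a DEGREE-CLASSIFIED target, ANY two morphisms of `F^{⊩▶×μ}`-prime-strips have the same global component.
[cite: Mochizuki2012, Cor 4.6 (ii) p.138] -/
theorem classEquiv_eq_classEquiv (hT : Function.Injective T.data.realifiedF.degClass) (f g : S ⟶ T) :
    f.classEquiv = g.classEquiv :=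
  RealifiedGlobalFrobenioidF.equiv_eq_of_degClass_eq hT _ _ f.degClass_eq g.degClass_eq

/-- **IUTchII:Cor4.6(ii)** (kurims p.138) into a degree-classified target a morphism of `F^{⊩▶×μ}`-prime-strips is
DETERMINED BY ITS LOCAL PART. [cite: Mochizuki2012, Cor 4.6 (ii) p.138] -/
theorem ext_of_locSplitIso_eq (hT : Function.Injective T.data.realifiedF.degClass) {f g : S ⟶ T}
    (h : f.locSplitIso = g.locSplitIso) : f = g :=
  Hom.ext' (classEquiv_eq_classEquiv hT f g) h

/-- **IUTchI:Rmk5.2.1(ii)** (kurims p.143) «rigidity»: every automorphism of a degree-classified `F^{⊩▶×μ}`-prime-strip has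
IDENTITY global component. [cite: Mochizuki2012, Def 4.9 (viii) p.158] -/
theorem classEquiv_eq_refl (hS : Function.Injective S.data.realifiedF.degClass) (f : S ⟶ S) :
    f.classEquiv = Equiv.refl _ :=
  classEquiv_eq_classEquiv hS f (𝟙 S)

end Hom

/-- **IUTchII:Def4.9(viii)** (kurims p.158) passing to the `F^{⊢▶×μ}`-prime-strip is INJECTIVE on `Hom(S, T)` for a
degree-classified target `T` (faithfulness of `toSplitStripFunctor` there). [cite: Mochizuki2012, Def 4.9 (viii) p.158] -/
theorem toSplitStripFunctor_map_injective (hT : Function.Injective T.data.realifiedF.degClass) :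
    Function.Injective (toSplitStripFunctor.map : (S ⟶ T) → (toSplitStripFunctor.obj S ⟶ toSplitStripFunctor.obj T)) :=
  fun _ _ h => Hom.ext_of_locSplitIso_eq hT h

/-- **IUTchII:Def4.9(viii)** (kurims p.158) at a degree-classified strip an automorphism with identity local part IS
the identity — the negation of the R9-F1 phenomenon there. [cite: Mochizuki2012, Def 4.9 (viii) p.158] -/
theorem eq_id_of_locSplitIso_eq_refl (hS : Function.Injective S.data.realifiedF.degClass) (f : S ⟶ S)
    (h : ∀ v, f.locSplitIso v = LocalTriMuDatum.SplitIso.refl _) : f = 𝟙 S :=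
  Hom.ext_of_locSplitIso_eq hS (funext h)

/-- Hence at a degree-classified strip there is NO non-identity automorphism with identity local part.
[cite: Mochizuki2012, Def 4.9 (viii) p.158] -/
theorem not_exists_aut_ne_id (hS : Function.Injective S.data.realifiedF.degClass) :
    ¬ ∃ f : S ⟶ S, f ≠ 𝟙 S ∧ ∀ v, f.locSplitIso v = LocalTriMuDatum.SplitIso.refl _ := by
  rintro ⟨f, hf, h⟩
  exact hf (eq_id_of_locSplitIso_eq_refl hS f h)

/-- At a degree-classified strip two isomorphism classes of the same degree coincide; in particular the right-hand
side of `exists_aut_ne_id_iff_exists_classes` is empty. [cite: MochizukiFrdI2008, Thm. 6.4 (i) p.114] -/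
theorem not_exists_classes (hS : Function.Injective S.data.realifiedF.degClass) :
    ¬ ∃ c₁ c₂ : S.data.realifiedF.IsoClass, c₁ ≠ c₂ ∧
        S.data.realifiedF.degClass c₁ = S.data.realifiedF.degClass c₂ ∧
        c₁ ≠ S.data.realifiedF.classOf S.data.pilot ∧ c₂ ≠ S.data.realifiedF.classOf S.data.pilot := by
  rintro ⟨c₁, c₂, hne, hdeg, -, -⟩
  exact hne (hS hdeg)

/-! ### §3 Fullness: compatible local isomorphisms extend uniquely (source and target degree-classified onto `ℝ`) -/

/-- **IUTchII:Def4.9(viii)** (kurims p.158) «the generators of the monoids `O^▶(−)` … together with the `{*ρ_w}`,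
determine … the pilot object»: a `V`-family of split local isomorphisms compatible with the valuations and the
generators identifies the LOCAL DEGREES of the pilot objects. [cite: Mochizuki2012, Def 4.9 (viii) p.158] -/
theorem pilot_localDeg_eq_of_local
    (e : ∀ v : V, LocalTriMuDatum.SplitIso (S.data.strip.localDatum v) (T.data.strip.localDatum v))
    (hrho : ∀ (v : V) (a : OTri (S.data.strip.localDatum v).O), T.data.rho v ((e v).eTri a) = S.data.rho v a)
    (hgen : ∀ (v : V) (h : P.kind v = PlaceKind.bad), (e v).eTri (S.data.triGen v h) = T.data.triGen v h) (v : V) :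
    T.data.realifiedF.localDeg T.data.pilot v = S.data.realifiedF.localDeg S.data.pilot v := by
  by_cases h : P.kind v = PlaceKind.bad
  · rw [T.data.pilot_localDeg_bad v h, S.data.pilot_localDeg_bad v h, ← hgen v h, hrho]
  · rw [T.data.pilot_localDeg_other v h, S.data.pilot_localDeg_other v h]

/-- … hence the (negative) DEGREES of the pilot objects. [cite: Mochizuki2012, Def 4.9 (viii) p.158] -/
theorem pilot_deg_eq_of_local
    (e : ∀ v : V, LocalTriMuDatum.SplitIso (S.data.strip.localDatum v) (T.data.strip.localDatum v))
    (hrho : ∀ (v : V) (a : OTri (S.data.strip.localDatum v).O), T.data.rho v ((e v).eTri a) = S.data.rho v a)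
    (hgen : ∀ (v : V) (h : P.kind v = PlaceKind.bad), (e v).eTri (S.data.triGen v h) = T.data.triGen v h) :
    T.data.realifiedF.deg T.data.pilot = S.data.realifiedF.deg S.data.pilot := by
  rw [T.data.realifiedF.deg_eq_finsum, S.data.realifiedF.deg_eq_finsum]
  exact finsum_congr (pilot_localDeg_eq_of_local e hrho hgen)

/-- **IUTchII:Def4.9(viii)** (kurims p.158) / [IUTchII] Cor 4.6 (ii) p.138 «uniquely determined»: between strips whose
global realified Frobenioids are degree-classified ONTO `ℝ`, every `V`-family of split local isomorphisms compatible
with the `ρ_v` and the generators at bad places EXTENDS UNIQUELY to a morphism of `F^{⊩▶×μ}`-prime-strips (global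
component = the degree-matching bijection of classes; pilot class ↦ pilot class because the local data pin the
pilot degree). [cite: Mochizuki2012, Def 4.9 (viii) p.158] -/
theorem existsUnique_hom_of_local (hS : Function.Bijective S.data.realifiedF.degClass)
    (hT : Function.Bijective T.data.realifiedF.degClass)
    (e : ∀ v : V, LocalTriMuDatum.SplitIso (S.data.strip.localDatum v) (T.data.strip.localDatum v))
    (hrho : ∀ (v : V) (a : OTri (S.data.strip.localDatum v).O), T.data.rho v ((e v).eTri a) = S.data.rho v a)
    (hgen : ∀ (v : V) (h : P.kind v = PlaceKind.bad), (e v).eTri (S.data.triGen v h) = T.data.triGen v h) :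
    ∃! f : S ⟶ T, f.locSplitIso = e := by
  obtain ⟨σ, hσ⟩ := RealifiedGlobalFrobenioidF.exists_equiv_degClass_eq hS hT
  refine ⟨{ classEquiv := σ
            degClass_eq := hσ
            map_pilotClass := hT.1 ?_
            locSplitIso := e
            map_rho := hrho
            map_triGen := hgen }, rfl, fun g hg => Hom.ext_of_locSplitIso_eq hT.1 hg⟩
  rw [hσ, RealifiedGlobalFrobenioidF.degClass_classOf, RealifiedGlobalFrobenioidF.degClass_classOf]
  exact (pilot_deg_eq_of_local e hrho hgen).symm

/-- **IUTchII:Def4.9(viii)** (kurims p.158) between degree-classified (onto `ℝ`) strips THE HOM-SET IS THE SET OF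
COMPATIBLE LOCAL ISOMORPHISMS: `f ↦ (local part, its two compatibilities)` is a bijection.
[cite: Mochizuki2012, Def 4.9 (viii) p.158] -/
theorem locSplitIso_bijective (hS : Function.Bijective S.data.realifiedF.degClass)
    (hT : Function.Bijective T.data.realifiedF.degClass) :
    Function.Bijective fun f : S ⟶ T =>
      (⟨f.locSplitIso, f.map_rho, f.map_triGen⟩ :
        {e : ∀ v : V, LocalTriMuDatum.SplitIso (S.data.strip.localDatum v) (T.data.strip.localDatum v) //
          (∀ (v : V) (a : OTri (S.data.strip.localDatum v).O), T.data.rho v ((e v).eTri a) = S.data.rho v a) ∧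
          ∀ (v : V) (h : P.kind v = PlaceKind.bad), (e v).eTri (S.data.triGen v h) = T.data.triGen v h}) := by
  refine ⟨fun f g h => Hom.ext_of_locSplitIso_eq hT.1 (congrArg Subtype.val h), fun ⟨e, hrho, hgen⟩ => ?_⟩
  obtain ⟨f, hf, -⟩ := existsUnique_hom_of_local hS hT e hrho hgen
  exact ⟨f, Subtype.ext hf⟩

/-- **IUTchII:Def4.9(viii)** (kurims p.158) between degree-classified (onto `ℝ`) strips, `S ≅ T` as `F^{⊩▶×μ}`-prime-strips
IFF some `V`-family of split local isomorphisms is compatible with the `ρ_v` and the generators.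
[cite: Mochizuki2012, Def 4.9 (viii) p.158] -/
theorem nonempty_iso_iff_exists_local (hS : Function.Bijective S.data.realifiedF.degClass)
    (hT : Function.Bijective T.data.realifiedF.degClass) :
    Nonempty (S ≅ T) ↔
      ∃ e : ∀ v : V, LocalTriMuDatum.SplitIso (S.data.strip.localDatum v) (T.data.strip.localDatum v),
        (∀ (v : V) (a : OTri (S.data.strip.localDatum v).O), T.data.rho v ((e v).eTri a) = S.data.rho v a) ∧
        ∀ (v : V) (h : P.kind v = PlaceKind.bad), (e v).eTri (S.data.triGen v h) = T.data.triGen v h := by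
  constructor
  · rintro ⟨i⟩
    exact ⟨i.hom.locSplitIso, i.hom.map_rho, i.hom.map_triGen⟩
  · rintro ⟨e, hrho, hgen⟩
    obtain ⟨f, -, -⟩ := existsUnique_hom_of_local hS hT e hrho hgen
    exact ⟨(Groupoid.isoEquivHom S T).symm f⟩

/-! ### §4 Non-vacuity of the hypothesis: the witness strip's `realLine` is degree-classified onto `ℝ` -/

namespace Witness

/-- abc-iut-w5-d087's `realLine` (objects `ℝ`, isomorphism `=`, `deg = id`, one local component) is DEGREE-CLASSIFIED
ONTO `ℝ`: `degClass` is a bijection. [cite: MochizukiFrdI2008, Thm. 6.4 (i) p.114] -/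
theorem realLine_degClass_bijective : Function.Bijective realLine.degClass := by
  constructor
  · intro a b
    induction a using Quotient.inductionOn with
    | h x =>
      induction b using Quotient.inductionOn with
      | h y =>
        intro h
        exact Quotient.sound h
  · intro r
    exact ⟨realLine.classOf r, rfl⟩

/-- **IUTchII:Def4.9(viii)** (kurims p.158) NON-VACUITY of §2–§3's hypothesis at a genuine print-level strip: for every
prime `p` and every `l`, abc-iut-w5-d087's explicit `F^{⊩▶×μ}`-prime-strip over one bad place (local monoid `ℤ_[p] ∖ {0}`,
`ρ = ord_p`, generator `p`, pilot `−1`) has a DEGREE-CLASSIFIED (onto `ℝ`) global realified Frobenioid.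
[cite: Mochizuki2012, Def 4.9 (viii) p.158] -/
theorem nonempty_degClassified (p : ℕ) [Fact p.Prime] (l : ℕ) :
    ∃ (X : ∀ _ : Unit, GroupTheoreticUnits.{0, 0} Unit)
      (S : FVdashSplitTriMuPrimeStrip.{0, 0, 0} (badOnly l) (fun _ => Unit) X),
      Function.Bijective S.data.realifiedF.degClass := by
  let M : CoveringMonoid.{0, 0} Unit := ⟨CommMonCat.of (nonZeroDivisors ℤ_[p]), 1⟩
  let X : GroupTheoreticUnits.{0, 0} Unit :=
    { OxG := M.Oˣ, act := M.unitsAct, openSubgroups := Set.univ, zhatUnits := ⊥,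
      zhatUnits_comm := fun γ hγ g => by rw [Subgroup.mem_bot.mp hγ, one_mul, mul_one] }
  obtain ⟨κ⟩ := nonempty_kummerTimes_tautological Unit M Set.univ
  obtain ⟨κμ⟩ := nonempty_kummerTimesMu_tautological Unit M Set.univ
  let D : NonarchTriMuDatum.{0, 0, 0} l PlaceKind.bad Unit X :=
    ⟨CommMonCat.of (nonZeroDivisors ℤ_[p]), 1, Submonoid.powers (varpi p),
      OPerpPresentsAssociates_nonZeroDivisors_powers (PadicInt.irreducible_p (p := p)) (torsionOrder l .bad),
      κ, κμ⟩
  refine ⟨fun _ => X, { data := { realifiedF := realLine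
                                  strip := ⟨fun _ => LocalTriMuDatum.bad D⟩
                                  rho := fun _ => rho p
                                  triGen := fun _ _ => toOTri _ (varpi p)
                                  rho_triGen_pos := fun _ _ => ?_
                                  pilot := (-1 : ℝ)
                                  pilot_localDeg_bad := fun _ _ => ?_
                                  pilot_localDeg_other := fun _ h => (h rfl).elim } },
    realLine_degClass_bijective⟩
  · show 0 < Multiplicative.toAdd (rho p (toOTri _ (varpi p)))
    rw [rho_varpi, toAdd_ofAdd]; exact one_pos
  · show (-1 : ℝ) = -((Multiplicative.toAdd (rho p (toOTri _ (varpi p))) : NNReal) : ℝ)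
    rw [rho_varpi, toAdd_ofAdd, NNReal.coe_one]

/-- … so at that strip every automorphism with identity local part is the identity (§2 applies non-vacuously).
[cite: Mochizuki2012, Def 4.9 (viii) p.158] -/
theorem exists_rigid_strip (p : ℕ) [Fact p.Prime] (l : ℕ) :
    ∃ (X : ∀ _ : Unit, GroupTheoreticUnits.{0, 0} Unit)
      (S : FVdashSplitTriMuPrimeStrip.{0, 0, 0} (badOnly l) (fun _ => Unit) X),
      ∀ f : S ⟶ S, (∀ v, f.locSplitIso v = LocalTriMuDatum.SplitIso.refl _) → f = 𝟙 S := by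
  obtain ⟨X, S, hS⟩ := nonempty_degClassified p l
  exact ⟨X, S, fun f hf => eq_id_of_locSplitIso_eq_refl hS.1 f hf⟩

end Witness

end FVdashSplitTriMuPrimeStrip

end Literature.IUT.HodgeArakelov
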